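import Summits.AtomisticToContinuum.Crystallization.Theorems.FrustratedLawDichotomyAveragingRule

/-!
# FrustratedLawDichotomy · the CAPPED ball-averaging rule: a certified LOCAL member of the motif door, and `LAP^D` is MOTIF-LOCAL

Continuation of `…AveragingRule` (hand-2 g13, p829595: lens-5's `LAP_ρ` is LITERALLY the sitewise certificate of `avgRule ρ surplus`;
`HasRange ρ` proved; `IsLocal` / `IsBounded` from the feature).  THE HONEST CAVEAT: lens-5's surplus carries the UNCAPPED flags `GoodAt η`,
and `GoodAt` is SCALE-FREE — a site whose nearest neighbour sits at distance `d` reads atoms out to `13/10·d`, `d` unbounded (a perfect kissing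
dozen at scale `d > ρ₁` around an otherwise isolated atom is good; its `ρ₁`-sub-cluster `{centre}` is not) — so the uncapped averaging rule is
NOT `IsLocal` at any fixed radius.  THE REPAIR (this file) is hand-2 g12's capped flag `goodFlag η D = 𝟙[GoodAtScale η D]`
(`…RuleToolkitGood.goodFlag_isLocal`, `η ≤ 3/10`, radius `13/10·D + 1`):

* §3 `surplusCap η₀ η₁ D W e κ_T C_T` (flags capped at fit scale `D`) is a `ρ₁`-LOCAL feature for `ρ₁ ≥ max (R_W, 13/10·D + 1)`
  (`surplusCap_isLocal`), `surplusCap ≤ surplus` for `κ_T, C_T ≥ 0` (a site good only at a scale `> D` is charged as bad — the safe direction),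
  hence `LAP^D_ρ := BallAveragedPricingCap ⟹ LAP_ρ ⟹ T′♭` (`ballAveragedPricing_of_cap`, `schurTopologicalPricing_of_ballAveragedCap`),
  and `avgRule ρ (surplusCap …)` has range `ρ` and locality `ρ₁` as THEOREMS (`avgRuleCap_restricted`; bound `B` via `clipFeature`, §1 of part A).
* §4 ★★ `LAP^D` IS MOTIF-LOCAL: for `ϱ ≥ ρ + ρ₁` the cluster statement (every injective `7/10`-separated cluster, every site) is EQUIVALENT to
  its restriction to the CENTRE of radius-`ϱ` motifs (`ballAveragedPricingCap_iff_motif`; the motif of a site reproduces its capped ball average,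
  `motif_ballAvgCap`, by `netInflow_motif` + feature locality + the exact identity), and the motif statement is LITERALLY
  `PairRuleMotifCertificate η₀ η₁ W A (eUp + κ_T) (−C_T) (−κ_T) D ϱ (avgRule ρ (surplusCap …))` (`pairRuleMotifCertificate_avgRule_iff`).
  So lens-5's door `D_AVG` (capped) is ONE POINT of the motif door's certified search space (census TAG 181 (c)): an `F2`-adversary of
  TAG 181-S(iii)-AVG is a motif counterexample for this one rule, a motif certificate for it closes `T′♭` through either door; by
  `…MotifCount.motif_card_le` the motif family is finite in size (`≤ (20ϱ/7 + 1)³` atoms).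
* §5 kernels BY NAME: `schurTopologicalPricing_of_ballAveragedMotifCap` (any Schur cut whose `effPot` vanishes from `R` on), the crux
  `aperiodicFrustratedLawGap_of_ballAveragedMotifCap` (generic), ★ `aperiodicFrustratedLawGap_fourHalf_of_ballAveragedMotifCap` (record node
  `W₄₅ = effPot w₄₅ ω₄ (3/400)`, `e₄₅ = −0.7175 + 3/400`; one-shell literal `ρ = 23/20, D = 3/2, ρ₁ = 9/2, ϱ = 113/20`:
  `…_oneShell`), the range-5 twin, and the cluster form `aperiodicFrustratedLawGap_fourHalf_of_ballAveragedCap`.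

[folklore] bookkeeping (discharging); 0 sorry.  Prover hand 2, gen 13 (decomp-a2c), `--supports stmt-AtomisticToContinuum-27623`.
-/

noncomputable section

namespace Summit.AtomisticToContinuum.Crystallization.Theorems.FrustratedLawDichotomyAveragingRuleCap

open scoped BigOperators Classical
open Literature.MathematicalPhysics.StatisticalMechanics (interactionEnergy siteEnergy)
open Summit.AtomisticToContinuum.Crystallization.Theorems.ChargedEnergyGapNegative (E3)
open Summit.AtomisticToContinuum.Crystallization.Theorems.FrustratedLawDichotomyRangeCut
open Summit.AtomisticToContinuum.Crystallization.Theorems.FrustratedLawDichotomySchurCut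
open Summit.AtomisticToContinuum.Crystallization.Theorems.FrustratedLawDichotomyLocalDischargingRule
open Summit.AtomisticToContinuum.Crystallization.Theorems.FrustratedLawDichotomyMotifLemmas
open Summit.AtomisticToContinuum.Crystallization.Theorems.FrustratedLawDichotomyPairPotentialDoor
open Summit.AtomisticToContinuum.Crystallization.Theorems.FrustratedLawDichotomyRuleToolkit
open Summit.AtomisticToContinuum.Crystallization.Theorems.FrustratedLawDichotomyRuleToolkitGood
open Summit.AtomisticToContinuum.Crystallization.Theorems.FrustratedLawDichotomyAveragingCut
  (surplus ball ballAvg mem_ball card_ball_pos BallAveragedPricing schurTopologicalPricing_of_ballAveraged)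
open Summit.AtomisticToContinuum.Crystallization.Theorems.FrustratedLawDichotomyAveragingRule

/-! ## §3. The CAPPED surplus: a local feature, below the surplus, and `LAP^D ⟹ LAP ⟹ T′♭` -/

/-- **Pair-sum feature** `Σ_k W(dist (y j) (y k))` (`= siteEnergy W y j + W 0`). -/
def pairSumFeature (W : ℝ → ℝ) : SiteFeature := fun N y j => ∑ k : Fin N, W (dist (y j) (y k))

/-- `pairSumFeature W` is `ρ`-local when `W` vanishes from `R ≤ ρ` on. [folklore] -/
theorem pairSumFeature_isLocal {W : ℝ → ℝ} {R ρ : ℝ} (hW : ∀ r, R ≤ r → W r = 0) (hR : R ≤ ρ) : IsLocalFeature ρ (pairSumFeature W) := by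
  intro N M y φ hφ a hsub
  unfold pairSumFeature
  exact sum_comp_eq_sum_of_vanish hφ (fun k : Fin N => W (dist (y (φ a)) (y k))) fun j hj => by
    have hfar : ρ < dist (y j) (y (φ a)) := lt_of_not_ge fun hh => hj (hsub j hh)
    exact hW _ (by rw [dist_comm]; linarith)

/-- **`surplusCap η₀ η₁ D W e κ_T C_T`** — lens-5's surplus with the crystallinity flags CAPPED at fit scale `D`
(`goodFlag η D = 𝟙[GoodAtScale η D]`): `x^D_j = (Σ_k W(r_jk) − W 0)/2 − e − κ_T·(1 − 𝟙[GoodAtScale η₁ D j]) + C_T·𝟙[GoodAtScale η₀ D j]`. -/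
def surplusCap (η₀ η₁ D : ℝ) (W : ℝ → ℝ) (e κT CT : ℝ) : SiteFeature := fun N y j =>
  (pairSumFeature W N y j - W 0) / 2 - e - κT * (1 - goodFlag η₁ D N y j) + CT * goodFlag η₀ D N y j

/-- ★ **The capped surplus is a LOCAL feature** of radius `ρ₁ ≥ max (R, 13/10·D + 1)` (`W` vanishing from `R` on, `η₀, η₁ ≤ 3/10`). [folklore] -/
theorem surplusCap_isLocal {η₀ η₁ D : ℝ} {W : ℝ → ℝ} {e κT CT R ρ₁ : ℝ} (hW : ∀ r, R ≤ r → W r = 0) (hR : R ≤ ρ₁)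
    (hη₀ : η₀ ≤ 3 / 10) (hη₁ : η₁ ≤ 3 / 10) (hD : 13 / 10 * D + 1 ≤ ρ₁) :
    IsLocalFeature ρ₁ (surplusCap η₀ η₁ D W e κT CT) := by
  intro N M y φ hφ a hsub
  unfold surplusCap
  rw [pairSumFeature_isLocal hW hR N M y φ hφ a hsub, goodFlag_isLocal hη₀ hD N M y φ hφ a hsub,
    goodFlag_isLocal hη₁ hD N M y φ hφ a hsub]

/-- **Capping only lowers the surplus** (`κ_T, C_T ≥ 0`): a site good at a scale `> D` is charged as bad — the safe direction. [folklore] -/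
theorem surplusCap_le_surplus {η₀ η₁ D : ℝ} {W : ℝ → ℝ} {e κT CT : ℝ} (hκ : 0 ≤ κT) (hC : 0 ≤ CT) (N : ℕ) (y : Fin N → E3) (j : Fin N) :
    surplusCap η₀ η₁ D W e κT CT N y j ≤ surplus η₀ η₁ W e κT CT y j := by
  unfold surplusCap surplus goodFlag pairSumFeature
  rw [siteEnergy_eq]
  have h0 := ite_le_ite_of_imp (fun h : GoodAtScale η₀ D y j => h.goodAt)
  have h1 := ite_le_ite_of_imp (fun h : GoodAtScale η₁ D y j => h.goodAt)
  nlinarith [mul_le_mul_of_nonneg_left h0 hC, mul_le_mul_of_nonneg_left h1 hκ]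

/-- Ball averages are monotone in the site functional (weights `1/#B(j,ρ) ≥ 0`). [folklore] -/
theorem ballAvg_mono {ρ : ℝ} {N : ℕ} (y : Fin N → E3) {x x' : Fin N → ℝ} (h : ∀ j, x j ≤ x' j) (i : Fin N) :
    ballAvg ρ y x i ≤ ballAvg ρ y x' i := by
  unfold ballAvg
  exact Finset.sum_le_sum fun j _ => div_le_div_of_nonneg_right (h j) (Nat.cast_nonneg _)

/-- **`LAP^D_ρ = BallAveragedPricingCap ρ η₀ η₁ D W e κ_T C_T`** — ball-averaged pricing with CAPPED flags: at every site of every injective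
`7/10`-separated cluster the ball average of the capped surpluses is `≥ 0`. -/
def BallAveragedPricingCap (ρ η₀ η₁ D : ℝ) (W : ℝ → ℝ) (e κT CT : ℝ) : Prop :=
  ∀ (N : ℕ) (y : Fin N → E3), Function.Injective y → Sep y → ∀ i : Fin N, 0 ≤ ballAvg ρ y (surplusCap η₀ η₁ D W e κT CT N y) i

/-- ★ `LAP^D_ρ ⟹ LAP_ρ` (`κ_T, C_T ≥ 0`). [folklore] -/
theorem ballAveragedPricing_of_cap {ρ η₀ η₁ D : ℝ} {W : ℝ → ℝ} {e κT CT : ℝ} (hκ : 0 ≤ κT) (hC : 0 ≤ CT)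
    (h : BallAveragedPricingCap ρ η₀ η₁ D W e κT CT) : BallAveragedPricing ρ η₀ η₁ W e κT CT :=
  fun N y hy hs i => (h N y hy hs i).trans (ballAvg_mono y (fun j => surplusCap_le_surplus hκ hC N y j) i)

/-- ★ `LAP^D_ρ ⟹ T′♭` for any Schur cut (`ρ ≥ 0`, `κ_T, C_T ≥ 0`). [folklore chaining] -/
theorem schurTopologicalPricing_of_ballAveragedCap {ρ η₀ η₁ D A eUp κT CT : ℝ} {w ω : ℝ → ℝ} (hρ : 0 ≤ ρ) (hκ : 0 ≤ κT) (hC : 0 ≤ CT)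
    (h : BallAveragedPricingCap ρ η₀ η₁ D (effPot w ω A) (eUp + A) κT CT) : SchurTopologicalPricing η₀ η₁ w ω A eUp κT CT :=
  schurTopologicalPricing_of_ballAveraged hρ (ballAveragedPricing_of_cap hκ hC h)

/-- ★ **The capped averaging rule is a CERTIFIED member of the motif door's search space**: range `ρ`, locality `ρ₁`
(`ρ ≤ ρ₁`, `R ≤ ρ₁`, `13/10·D + 1 ≤ ρ₁`); with the clip of §1 also bound `B`. [folklore] -/
theorem avgRuleCap_restricted {ρ ρ₁ η₀ η₁ D : ℝ} {W : ℝ → ℝ} {e κT CT R : ℝ} (hW : ∀ r, R ≤ r → W r = 0) (hρ : ρ ≤ ρ₁) (hR : R ≤ ρ₁)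
    (hη₀ : η₀ ≤ 3 / 10) (hη₁ : η₁ ≤ 3 / 10) (hD : 13 / 10 * D + 1 ≤ ρ₁) :
    HasRange ρ (avgRule ρ (surplusCap η₀ η₁ D W e κT CT)) ∧ IsLocal ρ₁ (avgRule ρ (surplusCap η₀ η₁ D W e κT CT)) :=
  ⟨avgRule_hasRange _ _, avgRule_isLocal (surplusCap_isLocal hW hR hη₀ hη₁ hD) hρ⟩

/-- The capped surplus at level `e = eUp + A` is «site term minus CAPPED level». [folklore] -/
theorem surplusCap_eq (η₀ η₁ D : ℝ) (W : ℝ → ℝ) (A eUp κT CT : ℝ) {N : ℕ} (y : Fin N → E3) (j : Fin N) :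
    surplusCap η₀ η₁ D W (eUp + A) κT CT N y j =
      ((∑ k, W (dist (y j) (y k)) - W 0) / 2 - A) -
        ((eUp + κT) + (-CT) * (if GoodAtScale η₀ D y j then (1 : ℝ) else 0) + (-κT) * (if GoodAtScale η₁ D y j then (1 : ℝ) else 0)) := by
  unfold surplusCap goodFlag pairSumFeature
  ring

/-! ## §4. `LAP^D` is MOTIF-LOCAL; the motif statement is literally `PairRuleMotifCertificate` at the averaging rule -/

/-- **`BallAveragedMotifPricingCap ρ ϱ η₀ η₁ D W e κ_T C_T`** — `LAP^D_ρ` checked ONLY at the CENTRE `c` of injective `7/10`-separated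
MOTIFS confined to radius `ϱ` about `z c` (a finite family of sizes by `…MotifCount.motif_card_le`). -/
def BallAveragedMotifPricingCap (ρ ϱ η₀ η₁ D : ℝ) (W : ℝ → ℝ) (e κT CT : ℝ) : Prop :=
  ∀ (M : ℕ) (z : Fin M → E3), Function.Injective z → Sep z → ∀ c : Fin M, (∀ a : Fin M, dist (z a) (z c) ≤ ϱ) →
    0 ≤ ballAvg ρ z (surplusCap η₀ η₁ D W e κT CT M z) c

/-- ★ **LITERALLY**: the motif certificate of the motif door at the capped averaging rule IS `LAP^D` on motifs (`ρ ≥ 0`). [folklore] -/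
theorem pairRuleMotifCertificate_avgRule_iff {ρ ϱ η₀ η₁ D : ℝ} {W : ℝ → ℝ} {A eUp κT CT : ℝ} (hρ : 0 ≤ ρ) :
    PairRuleMotifCertificate η₀ η₁ W A (eUp + κT) (-CT) (-κT) D ϱ (avgRule ρ (surplusCap η₀ η₁ D W (eUp + A) κT CT)) ↔
      BallAveragedMotifPricingCap ρ ϱ η₀ η₁ D W (eUp + A) κT CT := by
  refine forall_congr' fun M => forall_congr' fun z => forall_congr' fun _ => forall_congr' fun _ => forall_congr' fun c =>
    forall_congr' fun _ => ?_
  have h := netInflow_avgRule hρ (surplusCap η₀ η₁ D W (eUp + A) κT CT) M z c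
  have e := surplusCap_eq η₀ η₁ D W A eUp κT CT z c
  constructor
  · intro h1; linarith
  · intro h1; linarith

/-- **THE MOTIF OF A SITE reproduces its capped ball average**: with `ϱ ≥ ρ + ρ₁` (`ρ₁` the locality radius of §3, `0 ≤ ρ ≤ ρ₁`), the
motif `{j : dist (y j) (y i) ≤ ϱ}` has the same `S^D` at its centre as the cluster has at `i`. [folklore] -/
theorem motif_ballAvgCap {η₀ η₁ D : ℝ} {W : ℝ → ℝ} {e κT CT R ρ ρ₁ ϱ : ℝ} (hW : ∀ r, R ≤ r → W r = 0)
    (hη₀ : η₀ ≤ 3 / 10) (hη₁ : η₁ ≤ 3 / 10) (h0 : 0 ≤ ρ) (hρ : ρ ≤ ρ₁) (hR : R ≤ ρ₁) (hD : 13 / 10 * D + 1 ≤ ρ₁) (hϱ : ρ + ρ₁ ≤ ϱ)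
    {N : ℕ} {y : Fin N → E3} (hy : Function.Injective y) (hsep : Sep y) (i : Fin N) :
    ∃ (M : ℕ) (z : Fin M → E3) (c : Fin M), Function.Injective z ∧ Sep z ∧ (∀ a : Fin M, dist (z a) (z c) ≤ ϱ) ∧
      ballAvg ρ z (surplusCap η₀ η₁ D W e κT CT M z) c = ballAvg ρ y (surplusCap η₀ η₁ D W e κT CT N y) i := by
  set S : Finset (Fin N) := Finset.univ.filter (fun j => dist (y j) (y i) ≤ ϱ) with hS
  have hSdef0 : ∀ j, j ∈ S ↔ dist (y j) (y i) ≤ ϱ := fun j => by simp [hS]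
  have hϱ0 : 0 ≤ ϱ := by linarith
  have hiS : i ∈ S := (hSdef0 i).2 (by rw [dist_self]; exact hϱ0)
  let φ : Fin S.card ↪o Fin N := S.orderEmbOfFin rfl
  have hφ : Set.range φ = ↑S := Finset.range_orderEmbOfFin S rfl
  have hiφ : i ∈ Set.range φ := by rw [hφ]; exact hiS
  obtain ⟨c, hc⟩ := hiφ
  have hSdef : ∀ j, j ∈ S ↔ dist (y j) (y (φ c)) ≤ ϱ := by rw [hc]; exact hSdef0
  have hSr : ∀ k : Fin N, dist (y k) (y (φ c)) ≤ ϱ → k ∈ Set.range φ := fun k hk => by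
    rw [hφ]; exact (hSdef k).2 hk
  have hφinj : Function.Injective φ := φ.injective
  set F : TransferRule := avgRule ρ (surplusCap η₀ η₁ D W e κT CT) with hF
  have hxloc : IsLocalFeature ρ₁ (surplusCap η₀ η₁ D W e κT CT) := surplusCap_isLocal hW hR hη₀ hη₁ hD
  have hF₁ : HasRange ρ F := avgRule_hasRange _ _
  have hF₂ : IsLocal ρ₁ F := avgRule_isLocal hxloc hρ
  refine ⟨S.card, y ∘ φ, c, hy.comp hφinj, fun a b hab => hsep (φ a) (φ b) (hφinj.ne hab), fun a => ?_, ?_⟩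
  · have ha : φ a ∈ S := by
      have h : φ a ∈ Set.range φ := ⟨a, rfl⟩
      rw [hφ] at h
      exact h
    exact (hSdef (φ a)).1 ha
  · have e1 : surplusCap η₀ η₁ D W e κT CT S.card (y ∘ φ) c = surplusCap η₀ η₁ D W e κT CT N y (φ c) :=
      hxloc N S.card y φ hφinj c fun k hk => hSr k (hk.trans (by linarith))
    have e2 : netInflow F S.card (y ∘ φ) c = netInflow F N y (φ c) :=
      netInflow_motif hF₁ hF₂ hϱ (by linarith) (by linarith) φ hφ hSdef
    have h1 := netInflow_avgRule h0 (surplusCap η₀ η₁ D W e κT CT) S.card (y ∘ φ) c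
    have h2 := netInflow_avgRule h0 (surplusCap η₀ η₁ D W e κT CT) N y (φ c)
    rw [← hc]
    rw [← hF] at h1 h2
    linarith

/-- ★★ **`LAP^D` IS MOTIF-LOCAL**: for `ϱ ≥ ρ + ρ₁` (`0 ≤ ρ ≤ ρ₁`, `R ≤ ρ₁`, `13/10·D + 1 ≤ ρ₁`, `η₀, η₁ ≤ 3/10`, `W` vanishing from `R` on),
`BallAveragedPricingCap ρ …` (all clusters, all sites) ⟺ `BallAveragedMotifPricingCap ρ ϱ …` (radius-`ϱ` motifs, centre only). [folklore] -/
theorem ballAveragedPricingCap_iff_motif {η₀ η₁ D : ℝ} {W : ℝ → ℝ} {e κT CT R ρ ρ₁ ϱ : ℝ} (hW : ∀ r, R ≤ r → W r = 0)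
    (hη₀ : η₀ ≤ 3 / 10) (hη₁ : η₁ ≤ 3 / 10) (h0 : 0 ≤ ρ) (hρ : ρ ≤ ρ₁) (hR : R ≤ ρ₁) (hD : 13 / 10 * D + 1 ≤ ρ₁) (hϱ : ρ + ρ₁ ≤ ϱ) :
    BallAveragedPricingCap ρ η₀ η₁ D W e κT CT ↔ BallAveragedMotifPricingCap ρ ϱ η₀ η₁ D W e κT CT := by
  constructor
  · exact fun h M z hz hs c _ => h M z hz hs c
  · intro h N y hy hsep i
    obtain ⟨M, z, c, hz, hzs, hconf, heq⟩ := motif_ballAvgCap (e := e) (κT := κT) (CT := CT) hW hη₀ hη₁ h0 hρ hR hD hϱ hy hsep i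
    rw [← heq]
    exact h M z hz hzs c hconf

/-- ★★ **`T′♭ ⟸ LAP^D on motifs`** for any Schur cut whose `effPot` vanishes from `R` on (`η₀ ≤ η₁ ≤ 3/10`-type tolerances, `κ_T, C_T ≥ 0`).
[folklore chaining] -/
theorem schurTopologicalPricing_of_ballAveragedMotifCap {η₀ η₁ D A eUp κT CT R ρ ρ₁ ϱ : ℝ} {w ω : ℝ → ℝ}
    (hW : ∀ r, R ≤ r → effPot w ω A r = 0) (hη₀ : η₀ ≤ 3 / 10) (hη₁ : η₁ ≤ 3 / 10) (h0 : 0 ≤ ρ) (hρ : ρ ≤ ρ₁) (hR : R ≤ ρ₁)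
    (hD : 13 / 10 * D + 1 ≤ ρ₁) (hϱ : ρ + ρ₁ ≤ ϱ) (hκ : 0 ≤ κT) (hC : 0 ≤ CT)
    (h : BallAveragedMotifPricingCap ρ ϱ η₀ η₁ D (effPot w ω A) (eUp + A) κT CT) :
    SchurTopologicalPricing η₀ η₁ w ω A eUp κT CT :=
  schurTopologicalPricing_of_ballAveragedCap h0 hκ hC ((ballAveragedPricingCap_iff_motif hW hη₀ hη₁ h0 hρ hR hD hϱ).2 h)

/-- ★ **The crux from a Schur floor, `E′♭`, and `LAP^D` ON MOTIFS for the ball-averaging rule** (generic `w ω A`, `effPot` vanishing from `R`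
on; `1/20 ≤ η₁ ≤ 3/10`). [folklore chaining] -/
theorem aperiodicFrustratedLawGap_of_ballAveragedMotifCap {η₁ D A eUp κT CT κE CE DE R ρ ρ₁ ϱ : ℝ} {w ω : ℝ → ℝ}
    (h01 : (1 : ℝ) / 20 ≤ η₁) (hη₁ : η₁ ≤ 3 / 10)
    (hDoor : Summit.AtomisticToContinuum.Crystallization.Theses.GrainCoreNetworkSplit.MuEquilibriumDoor)
    (hSF : SchurFloor w ω A) (hU : PeriodicEnergyCeiling eUp) (hκT : 0 < κT) (hκE : 0 < κE)
    (hE : SchurElasticPricing (1 / 20) η₁ w ω A eUp κE CE DE)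
    (hW : ∀ r, R ≤ r → effPot w ω A r = 0) (h0 : 0 ≤ ρ) (hρ : ρ ≤ ρ₁) (hR : R ≤ ρ₁) (hD : 13 / 10 * D + 1 ≤ ρ₁) (hϱ : ρ + ρ₁ ≤ ϱ)
    (hC : 0 ≤ CT) (h : BallAveragedMotifPricingCap ρ ϱ (1 / 20) η₁ D (effPot w ω A) (eUp + A) κT CT) :
    Summit.AtomisticToContinuum.Crystallization.Theses.FrustratedLawDichotomy.AperiodicFrustratedLawGap :=
  aperiodicFrustratedLawGap_of_split_schurCut h01 hDoor hSF hU hκT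
    (schurTopologicalPricing_of_ballAveragedMotifCap hW (by norm_num) hη₁ h0 hρ hR hD hϱ hκT.le hC h) hκE hE

/-! ## §5. The record node (range 9/2) and its audited twin (range 5) -/

/-- ★ **`T′♭₄₅(1/100, C_T) ⟸ LAP^D_ρ on radius-ϱ motifs`** for `W₄₅ = effPot w₄₅ ω₄ (3/400)` at level `e₄₅ = −0.7175 + 3/400`
(`0 ≤ ρ ≤ ρ₁`, `9/2 ≤ ρ₁`, `13/10·D + 1 ≤ ρ₁`, `ρ + ρ₁ ≤ ϱ`, `0 ≤ C_T`). [folklore chaining] -/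
theorem schurTopologicalPricing_fourHalf_of_ballAveragedMotifCap {CT D ρ ρ₁ ϱ : ℝ} (h0 : 0 ≤ ρ) (hρ : ρ ≤ ρ₁) (hR : 9 / 2 ≤ ρ₁)
    (hD : 13 / 10 * D + 1 ≤ ρ₁) (hϱ : ρ + ρ₁ ≤ ϱ) (hC : 0 ≤ CT)
    (h : BallAveragedMotifPricingCap ρ ϱ (1 / 20) (1 / 8) D (effPot w₄₅ ω₄ (3 / 400)) (-(7175 / 10000) + 3 / 400) (1 / 100) CT) :
    SchurTopologicalPricing (1 / 20) (1 / 8) w₄₅ ω₄ (3 / 400) (-(7175 / 10000)) (1 / 100) CT :=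
  schurTopologicalPricing_of_ballAveragedMotifCap (fun r hr => effPot_fourHalf_eq_zero _ hr) (by norm_num) (by norm_num) h0 hρ hR hD hϱ
    (by norm_num) hC h

/-- ★★ **The crux `AperiodicFrustratedLawGap` (stmt-27623) BY NAME at the record node from `LAP^D` ON MOTIFS for the ball-averaging rule**:
`MuEquilibriumDoor ∧ SF₄₅ ∧ UP(−0.7175) ∧ E′♭₄₅(1/1000, C_E, D_E) ∧ BallAveragedMotifPricingCap ρ ϱ (1/20) (1/8) D W₄₅ e₄₅ (1/100) C_T
⟹ AperiodicFrustratedLawGap` (`0 ≤ ρ ≤ ρ₁`, `9/2 ≤ ρ₁`, `13/10·D + 1 ≤ ρ₁`, `ρ + ρ₁ ≤ ϱ`; e.g. `ρ = 23/20`, `D = 3/2`, `ρ₁ = 9/2`, `ϱ = 113/20`).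
[folklore chaining] -/
theorem aperiodicFrustratedLawGap_fourHalf_of_ballAveragedMotifCap {CT CE DE D ρ ρ₁ ϱ : ℝ}
    (hDoor : Summit.AtomisticToContinuum.Crystallization.Theses.GrainCoreNetworkSplit.MuEquilibriumDoor)
    (hSF : SF₄₅) (hU : PeriodicEnergyCeiling (-(7175 / 10000)))
    (hE : SchurElasticPricing (1 / 20) (1 / 8) w₄₅ ω₄ (3 / 400) (-(7175 / 10000)) (1 / 1000) CE DE)
    (h0 : 0 ≤ ρ) (hρ : ρ ≤ ρ₁) (hR : 9 / 2 ≤ ρ₁) (hD : 13 / 10 * D + 1 ≤ ρ₁) (hϱ : ρ + ρ₁ ≤ ϱ) (hC : 0 ≤ CT)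
    (h : BallAveragedMotifPricingCap ρ ϱ (1 / 20) (1 / 8) D (effPot w₄₅ ω₄ (3 / 400)) (-(7175 / 10000) + 3 / 400) (1 / 100) CT) :
    Summit.AtomisticToContinuum.Crystallization.Theses.FrustratedLawDichotomy.AperiodicFrustratedLawGap :=
  aperiodicFrustratedLawGap_of_ballAveragedMotifCap (by norm_num) (by norm_num) hDoor hSF hU (by norm_num) (by norm_num) hE
    (fun r hr => effPot_fourHalf_eq_zero _ hr) h0 hρ hR hD hϱ hC h

/-- The one-shell literal: `ρ = 23/20`, `D = 3/2`, `ρ₁ = 9/2`, `ϱ = 113/20` (numeric side conditions discharged). [folklore chaining] -/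
theorem aperiodicFrustratedLawGap_fourHalf_of_ballAveragedMotifCap_oneShell {CT CE DE : ℝ}
    (hDoor : Summit.AtomisticToContinuum.Crystallization.Theses.GrainCoreNetworkSplit.MuEquilibriumDoor)
    (hSF : SF₄₅) (hU : PeriodicEnergyCeiling (-(7175 / 10000)))
    (hE : SchurElasticPricing (1 / 20) (1 / 8) w₄₅ ω₄ (3 / 400) (-(7175 / 10000)) (1 / 1000) CE DE) (hC : 0 ≤ CT)
    (h : BallAveragedMotifPricingCap (23 / 20) (113 / 20) (1 / 20) (1 / 8) (3 / 2) (effPot w₄₅ ω₄ (3 / 400))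
      (-(7175 / 10000) + 3 / 400) (1 / 100) CT) :
    Summit.AtomisticToContinuum.Crystallization.Theses.FrustratedLawDichotomy.AperiodicFrustratedLawGap :=
  aperiodicFrustratedLawGap_fourHalf_of_ballAveragedMotifCap (ρ₁ := 9 / 2) hDoor hSF hU hE (by norm_num) (by norm_num) le_rfl
    (by norm_num) (by norm_num) hC h

/-- **Range-5 twin** (`W₅ = effPot w₅ ω₅ (13/4000)`, `e₅ = −0.7175 + 13/4000`, `5 ≤ ρ₁`). [folklore chaining] -/
theorem aperiodicFrustratedLawGap_five_of_ballAveragedMotifCap {CT CE DE D ρ ρ₁ ϱ : ℝ}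
    (hDoor : Summit.AtomisticToContinuum.Crystallization.Theses.GrainCoreNetworkSplit.MuEquilibriumDoor)
    (hSF : SF₅) (hU : PeriodicEnergyCeiling (-(7175 / 10000)))
    (hE : SchurElasticPricing (1 / 20) (1 / 8) w₅ ω₅ (13 / 4000) (-(7175 / 10000)) (1 / 1000) CE DE)
    (h0 : 0 ≤ ρ) (hρ : ρ ≤ ρ₁) (hR : 5 ≤ ρ₁) (hD : 13 / 10 * D + 1 ≤ ρ₁) (hϱ : ρ + ρ₁ ≤ ϱ) (hC : 0 ≤ CT)
    (h : BallAveragedMotifPricingCap ρ ϱ (1 / 20) (1 / 8) D (effPot w₅ ω₅ (13 / 4000)) (-(7175 / 10000) + 13 / 4000) (1 / 100) CT) :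
    Summit.AtomisticToContinuum.Crystallization.Theses.FrustratedLawDichotomy.AperiodicFrustratedLawGap :=
  aperiodicFrustratedLawGap_of_ballAveragedMotifCap (by norm_num) (by norm_num) hDoor hSF hU (by norm_num) (by norm_num) hE
    (fun r hr => effPot_five_eq_zero _ hr) h0 hρ hR hD hϱ hC h

/-- **Cluster form at the record node** (no motif radius): `LAP^D_ρ ⟹ crux` granted the same pieces. [folklore chaining] -/
theorem aperiodicFrustratedLawGap_fourHalf_of_ballAveragedCap {CT CE DE D ρ : ℝ}
    (hDoor : Summit.AtomisticToContinuum.Crystallization.Theses.GrainCoreNetworkSplit.MuEquilibriumDoor)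
    (hSF : SF₄₅) (hU : PeriodicEnergyCeiling (-(7175 / 10000)))
    (hE : SchurElasticPricing (1 / 20) (1 / 8) w₄₅ ω₄ (3 / 400) (-(7175 / 10000)) (1 / 1000) CE DE) (h0 : 0 ≤ ρ) (hC : 0 ≤ CT)
    (h : BallAveragedPricingCap ρ (1 / 20) (1 / 8) D (effPot w₄₅ ω₄ (3 / 400)) (-(7175 / 10000) + 3 / 400) (1 / 100) CT) :
    Summit.AtomisticToContinuum.Crystallization.Theses.FrustratedLawDichotomy.AperiodicFrustratedLawGap :=
  aperiodicFrustratedLawGap_of_split_schurCut (by norm_num) hDoor hSF hU (by norm_num)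
    (schurTopologicalPricing_of_ballAveragedCap h0 (by norm_num) hC h) (by norm_num) hE

end Summit.AtomisticToContinuum.Crystallization.Theorems.FrustratedLawDichotomyAveragingRuleCap

end
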